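import Literature.NumberTheory.Automorphic.NormGroupRelNorm
import HarnessLib

/-!
# The base change `C_K → C_L` of idèle class groups is injective for `L/K` Galois (`𝕀_K ∩ Lˣ = Kˣ`)

Topic `NumberTheory/Automorphic`; namespace `Literature.NumberTheory.Automorphic`. Everything here is proved.

For a finite Galois extension of number fields `L/K`, the base change of idèles
`AdeleRing.ideleBaseChange K L : 𝕀_K →* 𝕀_L` (`AdeleBaseChange.lean`, injective) induces
`classBaseChange K L : C_K →* C_L` on idèle class groups (`NormGroupRelNorm.lean`). Here:

* `mem_principalIdeles_of_ideleBaseChange_mem` — **`𝕀_K ∩ Lˣ = Kˣ`**: an idèle of `K` whose base change is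
  a principal idèle `(ℓ)`, `ℓ ∈ Lˣ`, is principal. Galois descent: `(ℓ) = x_L` is fixed by `Gal(L/K)`
  (`AdeleRing.smul_ideleBaseChange`), so by the tree's `exists_ideleBaseChange_eq_of_forall_smul_eq`
  (`NormGroupClosedProofs.lean`: a `Gal`-fixed principal idèle of `L` is the base change of a principal idèle of
  `K` — `IsGalois.mem_bot_iff_fixed`) and the injectivity of `ideleBaseChange`, `x` is principal;
  `ideleBaseChange_mem_principalIdeles_iff`.
* `classBaseChange_injective` — **`C_K → C_L` is injective**; `classBaseChange_eq_one_iff`.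

(Cassels–Fröhlich, Ch. VII (Tate) §2 / Neukirch VI (2.?) : `C_K → C_L^{G}` is injective — the first half of
"`H¹(G, C_L)`-free" statements; only injectivity is recorded here.) This is the tree-vocabulary form of the
`pub-hodgecm` package theorem `NumberField.classBaseChange_injective` (`HodgeCM/Literature/ClassBaseChangeInjective.lean`,
gen 5, gate run 24: PerL v5 §3.2 l. 310 "the idele class group of `L₀` … injects"), re-proved over the tree's
`IdeleClassGroup` / `classBaseChange`. Not here: properness / closed-embedding of `C_K → C_L` (the PKG's
`isClosedEmbedding_classBaseChange`, which needs the compactness of `C¹` in the PKG's dictionary).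

## References

* J. W. S. Cassels, A. Fröhlich (eds.), *Algebraic Number Theory* (1967), Ch. VII (Tate) §1.1 (Galois action on
  adèles and idèles), §2. [CasselsFrohlichANT1967]
-/

noncomputable section

open NumberField

namespace Literature.NumberTheory.Automorphic

variable (K L : Type) [Field K] [Field L] [Algebra K L] [NumberField K] [NumberField L] [IsGalois K L]

/-- **`𝕀_K ∩ Lˣ = Kˣ`** (Galois descent): if the base change `x_L` of an idèle `x` of `K` is a principal idèle of
`L`, then `x` is a principal idèle of `K`. [cite: CasselsFrohlichANT1967, Ch. VII §1.1] -/
theorem mem_principalIdeles_of_ideleBaseChange_mem {x : GaloisRepresentations.ideleGroup K}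
    (hx : AdeleRing.ideleBaseChange K L x ∈ GaloisRepresentations.principalIdeles L) :
    x ∈ GaloisRepresentations.principalIdeles K := by
  obtain ⟨x', hx', hxx'⟩ := exists_ideleBaseChange_eq_of_forall_smul_eq K L hx
    (fun σ => AdeleRing.smul_ideleBaseChange K L σ x)
  rwa [← AdeleRing.ideleBaseChange_injective K L hxx']

/-- `x_L` is principal iff `x` is (`L/K` Galois). [cite: CasselsFrohlichANT1967, Ch. VII §1.1] -/
theorem ideleBaseChange_mem_principalIdeles_iff (x : GaloisRepresentations.ideleGroup K) :
    AdeleRing.ideleBaseChange K L x ∈ GaloisRepresentations.principalIdeles L ↔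
      x ∈ GaloisRepresentations.principalIdeles K :=
  ⟨mem_principalIdeles_of_ideleBaseChange_mem K L, ideleBaseChange_mem_principalIdeles K L⟩

/-- **The base change of idèle class groups `C_K → C_L` is injective** for `L/K` Galois.
[cite: CasselsFrohlichANT1967, Ch. VII §2] -/
theorem classBaseChange_injective : Function.Injective (classBaseChange K L) := by
  refine (injective_iff_map_eq_one (classBaseChange K L)).mpr fun c hc => ?_
  induction c using QuotientGroup.induction_on with
  | H x =>
    rw [classBaseChange_mk, QuotientGroup.eq_one_iff] at hc
    exact (QuotientGroup.eq_one_iff x).mpr (mem_principalIdeles_of_ideleBaseChange_mem K L hc)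

/-- `[x]_L = 1 ↔ [x] = 1`. [cite: CasselsFrohlichANT1967, Ch. VII §2] -/
theorem classBaseChange_eq_one_iff (c : IdeleClassGroup K) : classBaseChange K L c = 1 ↔ c = 1 :=
  map_eq_one_iff (classBaseChange K L) (classBaseChange_injective K L)

end Literature.NumberTheory.Automorphic

end
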